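import Mathlib.RingTheory.Flat.Basic
import Mathlib.LinearAlgebra.TensorProduct.Prod
import Mathlib.LinearAlgebra.Basis.VectorSpace
import Mathlib.LinearAlgebra.Dimension.Constructions
import HarnessLib

/-!
# Intersections of tensor products of subspaces

For vector spaces `V`, `W` over a field `K` and subspaces `A, C ≤ V`, `B, D ≤ W`, the subspaces
`A ⊗ B` and `C ⊗ D` of `V ⊗ W` (the ranges of `TensorProduct.mapIncl`) intersect factor-wise:

`(A ⊗ B) ⊓ (C ⊗ D) = (A ⊓ C) ⊗ (B ⊓ D)` (`range_mapIncl_inf_range_mapIncl`).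

The proof is the standard flatness argument: `A ⊗ W ⊓ C ⊗ W = (A ⊓ C) ⊗ W` because `- ⊗ W` is exact
and `0 → A ⊓ C → V → V/A × V/C` is exact (`range_rTensor_subtype_inf`, and symmetrically
`range_lTensor_subtype_inf`), and `A ⊗ W ⊓ V ⊗ B = A ⊗ B` because `A ⊗ (W/B) → V ⊗ (W/B)` is injective
(`range_rTensor_inf_range_lTensor`). Everything holds verbatim for flat modules; it is stated over a
field, where every module is free, hence flat. The last section iterates to THREE factors inside
`V₀ ⊗ (V₁ ⊗ V₂)` (`range_map₃_inf_range_map₃`) and counts dimensions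
(`finrank_range_mapIncl`, `finrank_range_map₃`, `finrank_range_map₃_inf_eq_one`: three slot-wise
lines meet in a line).

USE (outside this file). In the computation cell `pub-hsemireg` (widening seat `w1-tw-2`, W1), note
`run/shared/lean/pub/pub-hsemireg/widen/W1/THETA-NULL-PLUS-tw2.md` §2 / §5 (LEMMA Θ²-DIV): spaces of
sections on a product of three abelian surfaces are tensor products of the slot-wise spaces (Künneth for
`H⁰` of box products), and a section lying in two such product subspaces lies in the product of the
slot-wise intersections — which is this file with `V = H⁰(S₀, ·) ⊗ H⁰(S₁, ·)`-type factors. The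
geometry (which slot-wise intersections occur) is NOT in this file.

HONEST FRAMING. Textbook linear algebra (Bourbaki, Algèbre II §7); no abelian variety, Hodge class or
semiregularity map appears here; nothing in this file says that HC, HC_CM or HC_AV holds.
-/

namespace Summit.Ventures.HSemireg

namespace TensorSubspace

open TensorProduct

variable {K : Type*} [Field K] {V W : Type*} [AddCommGroup V] [Module K V] [AddCommGroup W]
  [Module K W]

/-- `0 → A ⊓ C → V → V/A × V/C` is exact. [folklore] -/
theorem exact_subtype_inf_prod_mkQ (A C : Submodule K V) :
    Function.Exact (A ⊓ C).subtype ((A.mkQ).prod (C.mkQ)) := by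
  intro v
  constructor
  · intro hv
    rw [LinearMap.coe_prod, Function.prod_apply, Prod.mk_eq_zero, Submodule.mkQ_apply,
      Submodule.mkQ_apply, Submodule.Quotient.mk_eq_zero, Submodule.Quotient.mk_eq_zero] at hv
    exact ⟨⟨v, hv⟩, rfl⟩
  · rintro ⟨⟨u, hu⟩, rfl⟩
    rw [LinearMap.coe_prod, Function.prod_apply, Prod.mk_eq_zero, Submodule.subtype_apply,
      Submodule.mkQ_apply, Submodule.mkQ_apply, Submodule.Quotient.mk_eq_zero,
      Submodule.Quotient.mk_eq_zero]
    exact hu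

/-- `(A ⊗ W) ⊓ (C ⊗ W) = (A ⊓ C) ⊗ W` inside `V ⊗ W`. [folklore] -/
theorem range_rTensor_subtype_inf (A C : Submodule K V) :
    LinearMap.range (A.subtype.rTensor W) ⊓ LinearMap.range (C.subtype.rTensor W) =
      LinearMap.range ((A ⊓ C).subtype.rTensor W) := by
  apply le_antisymm
  · rintro x ⟨hxA, hxC⟩
    have hexA := Module.Flat.rTensor_exact W (LinearMap.exact_subtype_mkQ A)
    have hexC := Module.Flat.rTensor_exact W (LinearMap.exact_subtype_mkQ C)
    have hex := Module.Flat.rTensor_exact W (exact_subtype_inf_prod_mkQ A C)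
    have hA0 : (A.mkQ.rTensor W) x = 0 := (hexA x).2 hxA
    have hC0 : (C.mkQ.rTensor W) x = 0 := (hexC x).2 hxC
    refine (hex x).1 ?_
    -- compare `(g ⊗ W) x` with `((A.mkQ ⊗ W) x, (C.mkQ ⊗ W) x)` through `prodLeft`
    have key : (TensorProduct.prodLeft K K (V ⧸ A) (V ⧸ C) W).toLinearMap ∘ₗ
        (((A.mkQ).prod (C.mkQ)).rTensor W) =
        (A.mkQ.rTensor W).prod (C.mkQ.rTensor W) := by
      apply TensorProduct.ext'
      intro v w
      simp [LinearMap.rTensor_tmul]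
    have h2 : (TensorProduct.prodLeft K K (V ⧸ A) (V ⧸ C) W)
        ((((A.mkQ).prod (C.mkQ)).rTensor W) x) = 0 := by
      have := LinearMap.congr_fun key x
      rw [LinearMap.comp_apply, LinearEquiv.coe_coe, LinearMap.coe_prod, Function.prod_apply, hA0,
        hC0, Prod.mk_zero_zero] at this
      exact this
    exact (LinearEquiv.map_eq_zero_iff _).1 h2
  · have eA : (A ⊓ C).subtype.rTensor W =
        (A.subtype.rTensor W) ∘ₗ ((Submodule.inclusion inf_le_left).rTensor W) := by
      rw [← LinearMap.rTensor_comp, Submodule.subtype_comp_inclusion]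
    have eC : (A ⊓ C).subtype.rTensor W =
        (C.subtype.rTensor W) ∘ₗ ((Submodule.inclusion inf_le_right).rTensor W) := by
      rw [← LinearMap.rTensor_comp, Submodule.subtype_comp_inclusion]
    refine le_inf ?_ ?_
    · rw [eA]; exact LinearMap.range_comp_le_range _ _
    · rw [eC]; exact LinearMap.range_comp_le_range _ _

/-- `(V ⊗ B) ⊓ (V ⊗ D) = V ⊗ (B ⊓ D)` inside `V ⊗ W`. [folklore] -/
theorem range_lTensor_subtype_inf (B D : Submodule K W) :
    LinearMap.range (B.subtype.lTensor V) ⊓ LinearMap.range (D.subtype.lTensor V) =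
      LinearMap.range ((B ⊓ D).subtype.lTensor V) := by
  apply le_antisymm
  · rintro x ⟨hxB, hxD⟩
    have hexB := Module.Flat.lTensor_exact V (LinearMap.exact_subtype_mkQ B)
    have hexD := Module.Flat.lTensor_exact V (LinearMap.exact_subtype_mkQ D)
    have hex := Module.Flat.lTensor_exact V (exact_subtype_inf_prod_mkQ B D)
    have hB0 : (B.mkQ.lTensor V) x = 0 := (hexB x).2 hxB
    have hD0 : (D.mkQ.lTensor V) x = 0 := (hexD x).2 hxD
    refine (hex x).1 ?_
    have key : (TensorProduct.prodRight K K V (W ⧸ B) (W ⧸ D)).toLinearMap ∘ₗ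
        (((B.mkQ).prod (D.mkQ)).lTensor V) =
        (B.mkQ.lTensor V).prod (D.mkQ.lTensor V) := by
      apply TensorProduct.ext'
      intro v w
      simp [LinearMap.lTensor_tmul]
    have h2 : (TensorProduct.prodRight K K V (W ⧸ B) (W ⧸ D))
        ((((B.mkQ).prod (D.mkQ)).lTensor V) x) = 0 := by
      have := LinearMap.congr_fun key x
      rw [LinearMap.comp_apply, LinearEquiv.coe_coe, LinearMap.coe_prod, Function.prod_apply, hB0,
        hD0, Prod.mk_zero_zero] at this
      exact this
    exact (LinearEquiv.map_eq_zero_iff _).1 h2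
  · have eB : (B ⊓ D).subtype.lTensor V =
        (B.subtype.lTensor V) ∘ₗ ((Submodule.inclusion inf_le_left).lTensor V) := by
      rw [← LinearMap.lTensor_comp, Submodule.subtype_comp_inclusion]
    have eD : (B ⊓ D).subtype.lTensor V =
        (D.subtype.lTensor V) ∘ₗ ((Submodule.inclusion inf_le_right).lTensor V) := by
      rw [← LinearMap.lTensor_comp, Submodule.subtype_comp_inclusion]
    refine le_inf ?_ ?_
    · rw [eB]; exact LinearMap.range_comp_le_range _ _
    · rw [eD]; exact LinearMap.range_comp_le_range _ _

/-- `(A ⊗ W) ⊓ (V ⊗ B) = A ⊗ B` inside `V ⊗ W`. [folklore] -/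
theorem range_rTensor_inf_range_lTensor (A : Submodule K V) (B : Submodule K W) :
    LinearMap.range (A.subtype.rTensor W) ⊓ LinearMap.range (B.subtype.lTensor V) =
      LinearMap.range (TensorProduct.map A.subtype B.subtype) := by
  apply le_antisymm
  · rintro x ⟨⟨y, rfl⟩, hxB⟩
    have hexB := Module.Flat.lTensor_exact V (LinearMap.exact_subtype_mkQ B)
    have h0 : (B.mkQ.lTensor V) (A.subtype.rTensor W y) = 0 := (hexB _).2 hxB
    -- naturality: `(B.mkQ ⊗ V) ∘ (A.subtype ⊗ W) = (A.subtype ⊗ (W/B)) ∘ (B.mkQ ⊗ A)`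
    have hnat : (B.mkQ.lTensor V) (A.subtype.rTensor W y) =
        (A.subtype.rTensor (W ⧸ B)) ((B.mkQ.lTensor A) y) := by
      rw [← LinearMap.comp_apply, ← LinearMap.comp_apply, LinearMap.lTensor_comp_rTensor,
        LinearMap.rTensor_comp_lTensor]
    rw [hnat] at h0
    have hinj : Function.Injective (A.subtype.rTensor (W ⧸ B)) :=
      Module.Flat.rTensor_preserves_injective_linearMap _ A.injective_subtype
    have hy0 : (B.mkQ.lTensor A) y = 0 := hinj (by rw [h0, map_zero])
    have hexBA := Module.Flat.lTensor_exact A (LinearMap.exact_subtype_mkQ B)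
    obtain ⟨z, rfl⟩ := (hexBA y).1 hy0
    refine ⟨z, ?_⟩
    rw [← LinearMap.comp_apply, LinearMap.rTensor_comp_lTensor]
  · rw [← LinearMap.rTensor_comp_lTensor]
    refine le_inf (LinearMap.range_comp_le_range _ _) ?_
    rw [LinearMap.rTensor_comp_lTensor, ← LinearMap.lTensor_comp_rTensor]
    exact LinearMap.range_comp_le_range _ _

/-- **Tensor products of subspaces intersect factor-wise**: for subspaces `A, C ≤ V` and `B, D ≤ W`
of vector spaces over a field, `(A ⊗ B) ⊓ (C ⊗ D) = (A ⊓ C) ⊗ (B ⊓ D)` as subspaces of `V ⊗ W`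
(here `A ⊗ B := range (mapIncl A B)`). [folklore] -/
theorem range_mapIncl_inf_range_mapIncl (A C : Submodule K V) (B D : Submodule K W) :
    LinearMap.range (mapIncl A B) ⊓ LinearMap.range (mapIncl C D) =
      LinearMap.range (mapIncl (A ⊓ C) (B ⊓ D)) := by
  apply le_antisymm
  · intro x hx
    obtain ⟨hx1, hx2⟩ := hx
    have hr : ∀ (A' : Submodule K V) (B' : Submodule K W),
        LinearMap.range (mapIncl A' B') ≤ LinearMap.range (A'.subtype.rTensor W) := by
      intro A' B'
      rw [mapIncl, ← LinearMap.rTensor_comp_lTensor]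
      exact LinearMap.range_comp_le_range _ _
    have hl : ∀ (A' : Submodule K V) (B' : Submodule K W),
        LinearMap.range (mapIncl A' B') ≤ LinearMap.range (B'.subtype.lTensor V) := by
      intro A' B'
      rw [mapIncl, ← LinearMap.lTensor_comp_rTensor]
      exact LinearMap.range_comp_le_range _ _
    have h1 : x ∈ LinearMap.range ((A ⊓ C).subtype.rTensor W) := by
      rw [← range_rTensor_subtype_inf]
      exact ⟨hr A B hx1, hr C D hx2⟩
    have h2 : x ∈ LinearMap.range ((B ⊓ D).subtype.lTensor V) := by
      rw [← range_lTensor_subtype_inf]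
      exact ⟨hl A B hx1, hl C D hx2⟩
    have h := (range_rTensor_inf_range_lTensor (A ⊓ C) (B ⊓ D)).le ⟨h1, h2⟩
    exact h
  · exact le_inf (range_mapIncl_mono inf_le_left inf_le_left)
      (range_mapIncl_mono inf_le_right inf_le_right)

/-! ### Dimension count and three tensor factors

The use in LEMMA Θ²-DIV (note `THETA-NULL-PLUS-tw2.md` §2 (C7) / §5) is on a product of THREE slots:
sections of a box product `⊠_k M_k` on `S₀ × S₁ × S₂` are `H⁰(M₀) ⊗ H⁰(M₁) ⊗ H⁰(M₂)` (Künneth), and two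
product subspaces `⊗_k L_k`, `⊗_k R_k` meet in `⊗_k (L_k ⊓ R_k)`, of dimension `∏_k dim (L_k ⊓ R_k)`.
Below: the range of `f ⊗ g` only depends on the ranges (`range_map_eq_range_mapIncl`), the honest
triple map `A₀ ⊗ (A₁ ⊗ A₂) → V₀ ⊗ (V₁ ⊗ V₂)` has the same range as the iterated `mapIncl`
(`range_map_subtype_map_subtype`), the three-factor intersection formula
(`range_map₃_inf_range_map₃`), and the dimension of a product subspace (`finrank_range_mapIncl`,
`finrank_range_map₃`). -/

section ThreeFactors

variable {V₀ V₁ V₂ : Type*} [AddCommGroup V₀] [Module K V₀] [AddCommGroup V₁] [Module K V₁]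
  [AddCommGroup V₂] [Module K V₂]

/-- The range of `f ⊗ g` is the product subspace `range f ⊗ range g`. [folklore] -/
theorem range_map_eq_range_mapIncl {M N : Type*} [AddCommGroup M] [Module K M] [AddCommGroup N]
    [Module K N] (f : M →ₗ[K] V) (g : N →ₗ[K] W) :
    LinearMap.range (map f g) = LinearMap.range (mapIncl (LinearMap.range f) (LinearMap.range g)) := by
  rw [range_mapIncl]
  exact range_map f g

/-- The honest triple inclusion `A₀ ⊗ (A₁ ⊗ A₂) → V₀ ⊗ (V₁ ⊗ V₂)` has the same range as the iterated
two-factor inclusion `A₀ ⊗ (A₁ ⊗ A₂)′ → V₀ ⊗ (V₁ ⊗ V₂)`, `(A₁ ⊗ A₂)′ := range (mapIncl A₁ A₂)`.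
[folklore] -/
theorem range_map_subtype_map_subtype (A₀ : Submodule K V₀) (A₁ : Submodule K V₁)
    (A₂ : Submodule K V₂) :
    LinearMap.range (map A₀.subtype (map A₁.subtype A₂.subtype)) =
      LinearMap.range (mapIncl A₀ (LinearMap.range (mapIncl A₁ A₂))) := by
  conv_lhs => rw [range_map_eq_range_mapIncl, Submodule.range_subtype]

/-- **Three tensor factors intersect factor-wise**: for subspaces `A_k, C_k ≤ V_k` (`k = 0, 1, 2`) of
vector spaces over a field,
`(A₀ ⊗ A₁ ⊗ A₂) ⊓ (C₀ ⊗ C₁ ⊗ C₂) = (A₀ ⊓ C₀) ⊗ (A₁ ⊓ C₁) ⊗ (A₂ ⊓ C₂)` inside `V₀ ⊗ (V₁ ⊗ V₂)`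
(each product subspace being the range of the honest map `A₀ ⊗ (A₁ ⊗ A₂) → V₀ ⊗ (V₁ ⊗ V₂)`).
This is step (C7) of LEMMA Θ²-DIV with three slots. [folklore] -/
theorem range_map₃_inf_range_map₃ (A₀ C₀ : Submodule K V₀) (A₁ C₁ : Submodule K V₁)
    (A₂ C₂ : Submodule K V₂) :
    LinearMap.range (map A₀.subtype (map A₁.subtype A₂.subtype)) ⊓
        LinearMap.range (map C₀.subtype (map C₁.subtype C₂.subtype)) =
      LinearMap.range (map (A₀ ⊓ C₀).subtype (map (A₁ ⊓ C₁).subtype (A₂ ⊓ C₂).subtype)) := by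
  rw [range_map_subtype_map_subtype, range_map_subtype_map_subtype, range_map_subtype_map_subtype,
    range_mapIncl_inf_range_mapIncl, range_mapIncl_inf_range_mapIncl]

/-- `dim (A ⊗ B) = dim A · dim B` for the product subspace `A ⊗ B := range (mapIncl A B)` of
`V ⊗ W` (over a field `mapIncl` is injective). [folklore] -/
theorem finrank_range_mapIncl (A : Submodule K V) (B : Submodule K W) :
    Module.finrank K (LinearMap.range (mapIncl A B)) = Module.finrank K A * Module.finrank K B := by
  rw [LinearMap.finrank_range_of_inj (Module.Flat.tensorProduct_mapIncl_injective_of_right _ _),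
    Module.finrank_tensorProduct]

/-- `dim (A₀ ⊗ A₁ ⊗ A₂) = dim A₀ · dim A₁ · dim A₂` for the triple product subspace of
`V₀ ⊗ (V₁ ⊗ V₂)`; with `range_map₃_inf_range_map₃`: if every slot-wise intersection `A_k ⊓ C_k` is a
line, so is `(⊗ A_k) ⊓ (⊗ C_k)` (the count used in LEMMA Θ²-DIV: `L_k ∩ R_k = ℂ · s_k θ_k²`).
[folklore] -/
theorem finrank_range_map₃ (A₀ : Submodule K V₀) (A₁ : Submodule K V₁) (A₂ : Submodule K V₂) :
    Module.finrank K (LinearMap.range (map A₀.subtype (map A₁.subtype A₂.subtype))) =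
      Module.finrank K A₀ * Module.finrank K A₁ * Module.finrank K A₂ := by
  rw [range_map_subtype_map_subtype, finrank_range_mapIncl, finrank_range_mapIncl, mul_assoc]

/-- The line case spelled out: if `A_k ⊓ C_k` is one-dimensional for `k = 0, 1, 2`, then
`(A₀ ⊗ A₁ ⊗ A₂) ⊓ (C₀ ⊗ C₁ ⊗ C₂)` is one-dimensional. [folklore] -/
theorem finrank_range_map₃_inf_eq_one {A₀ C₀ : Submodule K V₀} {A₁ C₁ : Submodule K V₁}
    {A₂ C₂ : Submodule K V₂} (h₀ : Module.finrank K ↥(A₀ ⊓ C₀) = 1)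
    (h₁ : Module.finrank K ↥(A₁ ⊓ C₁) = 1) (h₂ : Module.finrank K ↥(A₂ ⊓ C₂) = 1) :
    Module.finrank K ↥(LinearMap.range (map A₀.subtype (map A₁.subtype A₂.subtype)) ⊓
        LinearMap.range (map C₀.subtype (map C₁.subtype C₂.subtype))) = 1 := by
  rw [range_map₃_inf_range_map₃, finrank_range_map₃, h₀, h₁, h₂]

end ThreeFactors

end TensorSubspace

end Summit.Ventures.HSemireg
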